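import Mathlib
import HarnessLib

set_option linter.dupNamespace false
set_option autoImplicit false

/-!
# (C4a) abstract skeleton — «rank one + character values with an EXPLICIT multiplier pin the class»:
# `x = C • y` in a torsion-free module, from ONE non-trivial relation `s • x = r • y` and `val_χ x = χ(C)·val_χ y`,
# `val_χ y ≠ 0` for almost all `χ` (ideator bsd-idea-20 g72; crux `EllipticUnitValueSevenOfGZK` = stmt-BirchSwinnertonDyer-19945)

Cell bsd-cm context (card `Lines/kato-perrin-riou-zp.md` v47 §0 (C); scope memo `bsd-cm-prr-ty1/g33/CarrierColumn-scope.md`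
row (C4a) and flag (F3)).  Row (C4a) of the carrier column is the RATIONAL comparison `∃ C ∈ R[1/7], EU 𝔟 = C • zeta` in
`A = 𝐇¹_K[1/7]`, «⇐ rank one of A over R[1/7] (K-side Thm 12.4 (2)) + zeta ≠ 0», and (F3) records «K-side Thm 12.4 (2) has
no tree theorem; (C4a) needs it or a binder».  THIS FILE is the module-theoretic skeleton of (C4a) with Kato's objects as
VARIABLES (nothing about them is defined or asserted):

* `eq_smul_of_rel_of_values` (THE SKELETON): `R` any commutative ring, `A` an `R`-module on which non-zero scalars act
  injectively (tf), `x y : A` bound by ONE non-trivial relation `s • x = r • y` (rank `≤ 1`), a family of «characters»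
  `ev i : R →+* F` into a field with additive «value» functionals `val i : A →+ F`, `R`-semilinear through `ev i`
  (the `χ`-components of the `K`-side dual exponential), a ZERO LEMMA for `R` along a filter `l` of characters
  (`(∀ᶠ i in l, ev i r = 0) → r = 0`: Weierstrass preparation / the tree's
  `eq_zero_of_bounded_of_forall_character_hasSum_zero_off_finset` for `Λ`, plus `1, √−7` independent over `ℚ₇` for
  `Λ_O = QuadOrder Λ (−7)`), an EXPLICIT `C : R` with `val i x = ev i C * val i y` eventually (the two value formulas
  (eV)/(eZ) of the `GenusSeven.KatoExpDatum`, row (C6-R), p800949 — successor of the EMPTY (C6) `DualExpValueDatum`,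
  g73 `DualExpDatumEmpty.isEmpty_dualExpValueDatum`; g74 re-word, Lean below is datum-free) and `val i y ≠ 0` eventually
  (★ / Rohrlich 13.5 (2)) ⟹ `x = C • y`.
* `exists_rel_two_of_rel_three`: the tree's K-side rank-one THEOREM in its (rk) letter — `∀ x y, ∃ s r₀ r₁ : Λ,
  (s, r₀, r₁) ≠ 0 ∧ s • x = r₀ • y + r₁ • (ϖ • y)` (`GenusSeven.PinnedKatoGenusFrame.rk_of_inputs`,
  `Summits/…/Additive/RamifiedSevenGenusKSideRank.lean` l.358, p783797, from GZK on `𝒞₇` by Shapiro `K/ℚ`) — becomes ONE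
  two-term relation over any `Λ`-algebra `R ∋ ϖ` in which `a + bϖ = 0 ⇒ a = b = 0` (the power basis `{1, ϖ}` of
  `QuadOrder Λ m = AdjoinRoot (X² − m)`), acting on the module through a scalar tower.
* `exists_rel_two_map_of_rel_two`: a two-term relation is pushed along an `R`-linear map (`toRat : IK.H → IK.H[1/7]`,
  `IwasawaCohomologyNumberFieldCMOrder` l.385) and re-based on elements `a, b` with `c • a = f x'`, `d • b = f y'` for
  regular `c, d` (powers of `7`, `mem_range_toRat_iff` l.394).

So (F3) needs NO binder: rank one enters (C4a) exactly through `rk_of_inputs` (tree) → `exists_rel_two_of_rel_three` →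
`exists_rel_two_map_of_rel_two` → `eq_smul_of_rel_of_values`; what (C4a) genuinely waits for is the VALUES datum (C6-R)
and ★'s non-vanishing, not algebra.  g74 DISPOSITION (memo `K2C10RowClosure-g74.md`, `C4aRankOne-g72.md` §5 n7): this
skeleton is an ABSTRACT SHADOW of the cell's block (R) `Additive/RamifiedSevenRationalComparisonOfInputs.lean` (p781873 +
part 2; ★ l.92 → ★′ l.245 → `rationalComparisonShape_of_inputs` l.266), which proves (C4a) in `Λ`-coordinates from the same
binders and is what ★ (KI) `integralComparisonShape_of_inputs` (p782137) consumes — OFF-ROAD: no port of this file is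
planned or needed; theorems below UNCHANGED (docstring-only v2).  HONEST LABEL: pure module algebra (Mathlib only); no definition, no fact, no
`sorry`; nothing here proves (C4a), (C4b) = K2ᶜ, PR^×, hR3c, Conj. 12.10, `X12.CMRamifiedSeven` or BSD for any curve;
stmt-BirchSwinnertonDyer-19945 is OPEN (zp v16, 4 stubs); no summit statement is proved by this seat.

References: K. Kato, Astérisque 295 (2004), Thm. 12.4 (2) p. 221, 13.5 (2) p. 227, (15.16.1) p. 265 «by values + 12.4 (2)»,
15.14 p. 264 [Kato2004Asterisque]; L. Washington, GTM 83, §7.1 (Weierstrass preparation) [Washington1997]; the tree's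
ℚ-side model `Literature/NumberTheory/EllipticCurves/Kato2004/ZetaLineRankOneRigidityProofs.lean` §2–§4.
-/

namespace Summit.BirchSwinnertonDyer.BirchSwinnertonDyer.Cruxes.EllipticUnitValueSevenOfGZK.C4aValuesPin

/-! ## §1 The skeleton: values with an explicit multiplier pin the class -/

section Pin

variable {R : Type*} [CommRing R] {A : Type*} [AddCommGroup A] [Module R A] {F : Type*} [Field F]
  {ι : Type*}

/-- **(C4a) skeleton.**  In an `R`-module `A` on which non-zero scalars act injectively, let `x, y` satisfy a
non-trivial relation `s • x = r • y`.  If along a filter `l` of «characters» `ev i : R →+* F` (a field) with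
`ev i`-semilinear value maps `val i : A →+ F` one has eventually `val i x = ev i C * val i y` and `val i y ≠ 0`,
and `R` has the zero lemma along `l`, then `x = C • y`.  (Apply `val i` to the relation: `ev i (s*C − r) · val i y = 0`,
so `s*C = r`; then `s • (x − C • y) = 0`; `s = 0` would force `r = 0`.)
[cite: Kato2004Asterisque, §15.16 (15.16.1) (p. 265) «by values», Thm. 12.4 (2) (p. 221), 13.5 (2) (p. 227)] -/
theorem eq_smul_of_rel_of_values
    (htf : ∀ (s : R) (m : A), s ≠ 0 → s • m = 0 → m = 0)
    {x y : A} (hrel : ∃ s r : R, (s ≠ 0 ∨ r ≠ 0) ∧ s • x = r • y)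
    (ev : ι → R →+* F) (val : ι → A →+ F)
    (hval : ∀ (i : ι) (r : R) (m : A), val i (r • m) = ev i r * val i m)
    (l : Filter ι) (hzero : ∀ r : R, (∀ᶠ i in l, ev i r = 0) → r = 0)
    (C : R) (hC : ∀ᶠ i in l, val i x = ev i C * val i y) (hy : ∀ᶠ i in l, val i y ≠ 0) :
    x = C • y := by
  obtain ⟨s, r, hsr, h⟩ := hrel
  -- the key identity `s * C = r` in `R`, from the zero lemma
  have hkey : s * C - r = 0 := by
    refine hzero _ ((hC.and hy).mono fun i hi => ?_)
    obtain ⟨hCi, hyi⟩ := hi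
    have h1 : val i (s • x) = val i (r • y) := by rw [h]
    rw [hval, hval, hCi, ← mul_assoc] at h1
    -- `h1 : ev i s * ev i C * val i y = ev i r * val i y`
    have h2 : (ev i (s * C - r)) * val i y = 0 := by
      rw [map_sub, map_mul, sub_mul, h1, sub_self]
    exact (mul_eq_zero.mp h2).resolve_right hyi
  have hsC : s * C = r := sub_eq_zero.mp hkey
  by_cases hs : s = 0
  · -- then `r = 0`, contradicting non-triviality
    have hr : r = 0 := by rw [← hsC, hs, zero_mul]
    exact absurd hr (hsr.resolve_left (not_not.mpr hs))
  · -- `s • (x - C • y) = 0`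
    have h3 : s • (x - C • y) = 0 := by
      rw [smul_sub, h, ← hsC, mul_smul, sub_self]
    exact sub_eq_zero.mp (htf s _ hs h3)

/-- The same with the exceptional characters given as a SET `T` outside which everything holds (e.g. a finite set of
characters of bounded conductor, Rohrlich): take `l = 𝓟 Tᶜ`. [cite: Kato2004Asterisque, 13.5 (2) (p. 227)] -/
theorem eq_smul_of_rel_of_values_off
    (htf : ∀ (s : R) (m : A), s ≠ 0 → s • m = 0 → m = 0)
    {x y : A} (hrel : ∃ s r : R, (s ≠ 0 ∨ r ≠ 0) ∧ s • x = r • y)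
    (ev : ι → R →+* F) (val : ι → A →+ F)
    (hval : ∀ (i : ι) (r : R) (m : A), val i (r • m) = ev i r * val i m)
    (T : Set ι) (hzero : ∀ r : R, (∀ i, i ∉ T → ev i r = 0) → r = 0)
    (C : R) (hC : ∀ i, i ∉ T → val i x = ev i C * val i y) (hy : ∀ i, i ∉ T → val i y ≠ 0) :
    x = C • y := by
  refine eq_smul_of_rel_of_values htf hrel ev val hval (Filter.principal Tᶜ) (fun r hr => hzero r ?_) C ?_ ?_
  · intro i hi
    exact (Filter.eventually_principal.mp hr) i hi
  · exact Filter.eventually_principal.mpr fun i hi => hC i hi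
  · exact Filter.eventually_principal.mpr fun i hi => hy i hi

end Pin

/-! ## §2 From the tree's (rk) letter (three `Λ`-terms with the CM operator) to one two-term relation over `R ∋ ϖ` -/

section Rk

variable {Λ : Type*} [CommRing Λ] {R : Type*} [CommRing R] [Algebra Λ R]
  {M : Type*} [AddCommGroup M] [Module Λ M] [Module R M] [IsScalarTower Λ R M]

/-- **(rk) ⇒ rank `≤ 1` over `R`.**  If `{1, ϖ}` is `Λ`-free in `R` (`a + b·ϖ = 0 ⇒ a = b = 0`, the power basis of
`QuadOrder Λ m = Λ[X]/(X² − m)`) and `M` is an `R`-module through a scalar tower, then a relation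
`s • x = r₀ • y + r₁ • (ϖ • y)` with `(s, r₀, r₁) ≠ 0` in `Λ³` — the letter of the tree's
`PinnedKatoGenusFrame.rk_of_inputs` with `ϖ • y = Φ.piK y` — is ONE non-trivial two-term relation over `R`:
`(algebraMap s) • x = (algebraMap r₀ + algebraMap r₁ * ϖ) • y`. [cite: Kato2004Asterisque, Thm. 12.4 (2) (p. 221), 15.14 (p. 264)] -/
theorem exists_rel_two_of_rel_three (ϖ : R)
    (hbasis : ∀ a b : Λ, algebraMap Λ R a + algebraMap Λ R b * ϖ = 0 → a = 0 ∧ b = 0)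
    {x y : M} (h : ∃ s r₀ r₁ : Λ, (s ≠ 0 ∨ r₀ ≠ 0 ∨ r₁ ≠ 0) ∧ s • x = r₀ • y + r₁ • (ϖ • y)) :
    ∃ s' r' : R, (s' ≠ 0 ∨ r' ≠ 0) ∧ s' • x = r' • y := by
  obtain ⟨s, r₀, r₁, hne, hrel⟩ := h
  refine ⟨algebraMap Λ R s, algebraMap Λ R r₀ + algebraMap Λ R r₁ * ϖ, ?_, ?_⟩
  · rcases hne with hs | hr
    · left
      intro hs0
      have := hbasis s 0 (by rw [hs0, map_zero, zero_mul, add_zero])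
      exact hs this.1
    · right
      intro hr0
      have := hbasis r₀ r₁ hr0
      rcases hr with h0 | h1
      · exact h0 this.1
      · exact h1 this.2
  · rw [algebraMap_smul, add_smul, mul_smul, algebraMap_smul, algebraMap_smul, hrel]

end Rk

/-! ## §3 Pushing a two-term relation along an `R`-linear map and re-basing it (localisation `IK.H → IK.H[1/7]`) -/

section Push

variable {R : Type*} [CommRing R] {M : Type*} [AddCommGroup M] [Module R M]
  {A : Type*} [AddCommGroup A] [Module R A]

/-- If `s • x' = r • y'` non-trivially in `M`, `f : M →ₗ[R] A`, and `a, b ∈ A` satisfy `c • a = f x'`, `d • b = f y'`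
with `c, d` regular in `R` (e.g. powers of `7` in the domain `Λ_O`), then `a, b` satisfy the non-trivial relation
`(s*c) • a = (r*d) • b`.  (Every element of the localisation `IK.H[1/7]` is of this form: `mem_range_toRat_iff`.)
[cite: Kato2004Asterisque, Thm. 12.4 (2) (p. 221)] -/
theorem exists_rel_two_map_of_rel_two (f : M →ₗ[R] A) {x' y' : M}
    (h : ∃ s r : R, (s ≠ 0 ∨ r ≠ 0) ∧ s • x' = r • y')
    {a b : A} {c d : R} (hc : IsLeftRegular c) (hd : IsLeftRegular d)
    (ha : c • a = f x') (hb : d • b = f y') :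
    ∃ s' r' : R, (s' ≠ 0 ∨ r' ≠ 0) ∧ s' • a = r' • b := by
  obtain ⟨s, r, hne, hrel⟩ := h
  refine ⟨s * c, r * d, ?_, ?_⟩
  · rcases hne with hs | hr
    · left
      intro h0
      apply hs
      -- `s * c = 0` with `c` regular ⇒ `s = 0`
      have : c * s = c * 0 := by rw [mul_comm c s, h0, mul_zero]
      exact hc this
    · right
      intro h0
      apply hr
      have : d * r = d * 0 := by rw [mul_comm d r, h0, mul_zero]
      exact hd this
  · rw [mul_smul, ha, mul_smul, hb, ← map_smul, ← map_smul, hrel]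

end Push

/-! ## §4 Sanity instance: the skeleton is not vacuous (`R = F = ℚ`, `A = ℚ`, one character = identity) -/

example : (6 : ℚ) = (3 : ℚ) • (2 : ℚ) := by
  refine eq_smul_of_rel_of_values (R := ℚ) (A := ℚ) (F := ℚ) (ι := Unit)
    (fun s m hs h => (mul_eq_zero.mp h).resolve_left hs)
    ⟨1, 3, Or.inl one_ne_zero, by norm_num⟩
    (fun _ => RingHom.id ℚ) (fun _ => AddMonoidHom.id ℚ) (fun _ r m => rfl) ⊤
    (fun r hr => by simpa using hr) 3 (by norm_num) (by norm_num)

end Summit.BirchSwinnertonDyer.BirchSwinnertonDyer.Cruxes.EllipticUnitValueSevenOfGZK.C4aValuesPin
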